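import Summits.Parity.BatemanHorn.Theses.AlmostPrimeZeros
import Summits.Parity.BatemanHorn.Theorems.AlmostPrimeZerosHadamardBookkeeping
import Summits.Parity.BatemanHorn.Theorems.AlmostPrimeZerosSystemMertens
import Summits.Parity.BatemanHorn.Theorems.AlmostPrimeZerosNormalityFromRepulsion

/-!
# Crux `SystemZeroRepulsion` (stmt-Parity-11291): the majorant the crux itself implies

Route `AlmostPrimeZeros`, crux `Summit.Parity.BatemanHorn.Theses.AlmostPrimeZeros.SystemZeroRepulsion`.
Notation: `S_x(z) = Σ_{0 ≤ n ≤ x} z^{s_f(n)}`, `L = log log x`, `T_f(x) = Σ_ρ ‖1 − ρ‖⁻²`.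

The reduction file (`…SystemZeroRepulsionReduction.lean`) shows
`DiscMajorant_{3/2} ∧ FarMomentWide ⟹ SystemZeroRepulsion`, where `DiscMajorant_{3/2}` is the one-sided
bound `‖S_x(z)‖ ≤ A x (log x)^{k(Re z−1)} e^{C‖z−1‖^{3/2}}` on `‖z − 1‖ ≤ 3L`.  This file records the
converse-direction majorant that the crux gives back UNCONDITIONALLY (the two supports it uses,
`HadamardBookkeeping` and `SystemMertens`, are proved route items):

* `globalMajorantSq_of_systemZeroRepulsion`: `SystemZeroRepulsion ⟹` for every Bateman–Horn system,
  `‖S_x(z)‖ ≤ (x+1)·(log x)^{k(Re z−1)}·e^{C(‖z−1‖ + ‖z−1‖²)}` for ALL `z ∈ ℂ` and all `x ≥ 2`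
  (Hadamard bookkeeping `‖P(z)‖ ≤ ‖P(1)‖ e^{−Re[(1−z)P′(1)/P(1)] + ½‖1−z‖² T}` at `P = S_x`, whose
  logarithmic derivative at `1` is the mean of `s_f`, `= kL + O(1)` by `SystemMertens`).

So the crux is sandwiched between two disc majorants with the SAME harmonic exponent `k(Re z − 1) log log x`
and budgets `e^{O(‖z−1‖^{3/2})}` (sufficient, with the far moment) and `e^{O(‖z−1‖²)}` (necessary); the
exponent `2` is exactly the Jensen-critical growth (a budget `e^{c r²}` allows `N₁(r) ≍ r²` and a
logarithmically divergent `∫ N₁(r) r⁻³ dr`), which is why the sufficient form asks for `3/2` (any exponent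
`< 2` would do).
-/

noncomputable section

namespace Summit.Parity.BatemanHorn.Cruxes.SystemZeroRepulsion.Reduction

open scoped BigOperators Nat
open Polynomial Finset
open Summit.Parity.BatemanHorn.Theorems
open Summit.Parity.BatemanHorn.Theorems.AlmostPrimeZerosNormality

/-- **The majorant implied by the crux.**  `SystemZeroRepulsion ⟹` for every Bateman–Horn system `f` there
is `C` with `‖Σ_{n≤x} z^{s_f(n)}‖ ≤ (x+1) (log x)^{k(Re z−1)} exp(C(‖z−1‖ + ‖z−1‖²))` for all `z ∈ ℂ`,
`x ≥ 2`.  Proof: Hadamard bookkeeping (`hadamardBookkeeping_proof`) at the exponent polynomial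
`P_x = Σ_{n≤x} X^{s_f(n)}` (`P_x(1) = x+1`, `P_x′(1)/P_x(1) = μ_x`, the mean of `s_f`), then
`−(1 − Re z)μ_x = k(Re z − 1)L + (1 − Re z)(kL − μ_x) ≤ k(Re z−1)L + C_M‖z−1‖` by `SystemMertens`
(`SystemMertens_proof`: `|μ_x − kL| ≤ C_M`) and `½‖1−z‖² T_f(x) ≤ ½|C_T|‖z−1‖²` by the crux; finally
`exp(k(Re z−1)L) = (log x)^{k(Re z−1)}` (`log x > 0`). -/
theorem globalMajorantSq_of_systemZeroRepulsion :
    Summit.Parity.BatemanHorn.Theses.AlmostPrimeZeros.SystemZeroRepulsion →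
      ∀ (k : ℕ) (f : Fin k → Polynomial ℤ), Literature.NumberTheory.Sieve.IsBatemanHornSystem f →
        ∃ C : ℝ, ∀ x : ℕ, 2 ≤ x → ∀ z : ℂ,
          ‖∑ n ∈ Finset.range (x + 1), (z : ℂ) ^ (∑ i, (((f i).eval (n : ℤ)).toNat.factorization.sum fun _ v => min v 2))‖ ≤
            ((x : ℝ) + 1) * (Real.log (x : ℝ)) ^ ((k : ℝ) * (z.re - 1)) *
              Real.exp (C * (‖z - 1‖ + ‖z - 1‖ ^ 2)) := by
  intro hZ k f hf
  obtain ⟨CM, hCM⟩ := SystemMertens_proof k f hf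
  obtain ⟨CT, hCT⟩ := hZ k f hf
  refine ⟨|CM| + |CT|, fun x hx z => ?_⟩
  set e : ℕ → ℕ := fun n => ∑ i, (((f i).eval (n : ℤ)).toNat.factorization.sum fun _ v => min v 2)
    with he
  set P : ℂ[X] := ∑ n ∈ range (x + 1), (X : ℂ[X]) ^ (e n) with hP
  set L : ℝ := Real.log (Real.log (x : ℝ)) with hL
  set S : ℕ := ∑ n ∈ range (x + 1), e n with hS
  set μ : ℝ := (S : ℝ) / ((x : ℝ) + 1) with hμ
  set T : ℝ := (P.roots.map (fun ρ : ℂ => (‖(1 : ℂ) - ρ‖ ^ 2)⁻¹)).sum with hTdef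
  have hx2 : (2 : ℝ) ≤ x := by exact_mod_cast hx
  have hlogx : 0 < Real.log (x : ℝ) := Real.log_pos (by linarith)
  -- Hadamard at `P`
  have hP1 : P.eval 1 = ((x + 1 : ℕ) : ℂ) := by rw [hP, eval_one_sum_X_pow, card_range]
  have hP1ne : P.eval 1 ≠ 0 := by rw [hP1]; exact_mod_cast Nat.succ_ne_zero x
  have hnormP1 : ‖P.eval 1‖ = (x : ℝ) + 1 := by rw [hP1, Complex.norm_natCast]; push_cast; ring
  have hquot : (derivative P).eval 1 / P.eval 1 = (μ : ℂ) := by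
    rw [hP, derivative_eval_one_sum_X_pow, ← hP, hP1, hμ, hS]
    push_cast
    ring
  have hre_eq : ((1 - z) * ((derivative P).eval 1 / P.eval 1)).re = (1 - z.re) * μ := by
    rw [hquot]; simp [Complex.mul_re]
  have hPz : P.eval z = ∑ n ∈ range (x + 1), z ^ (e n) := by rw [hP, eval_sum_X_pow]
  have hHad : ‖∑ n ∈ range (x + 1), z ^ (e n)‖ ≤
      ((x : ℝ) + 1) * Real.exp (-((1 - z.re) * μ) + 1 / 2 * ‖1 - z‖ ^ 2 * T) := by
    have h := hadamardBookkeeping_proof P hP1ne z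
    rw [hPz, hnormP1, hre_eq] at h
    exact h
  -- the two inputs: Mertens along `f` and the crux
  have hM : |μ - (k : ℝ) * L| ≤ CM := by simpa [hμ, hS, hL, he] using hCM x hx
  have hT : T ≤ CT := by simpa [hTdef, hP, he] using hCT x hx
  -- exponent bookkeeping
  have hzr : |1 - z.re| ≤ ‖z - 1‖ := by
    have h := Complex.abs_re_le_norm (1 - z)
    rw [norm_sub_rev] at h
    simpa using h
  have h1 : -((1 - z.re) * μ) ≤ (k : ℝ) * (z.re - 1) * L + |CM| * ‖z - 1‖ := by
    have h0 : -((1 - z.re) * μ) = (k : ℝ) * (z.re - 1) * L + (1 - z.re) * ((k : ℝ) * L - μ) := by ring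
    have h2 : (1 - z.re) * ((k : ℝ) * L - μ) ≤ |CM| * ‖z - 1‖ :=
      calc (1 - z.re) * ((k : ℝ) * L - μ) ≤ |(1 - z.re) * ((k : ℝ) * L - μ)| := le_abs_self _
        _ = |1 - z.re| * |(k : ℝ) * L - μ| := abs_mul _ _
        _ ≤ ‖z - 1‖ * |CM| := by
            refine mul_le_mul hzr ?_ (abs_nonneg _) (norm_nonneg _)
            rw [abs_sub_comm]; exact hM.trans (le_abs_self CM)
        _ = |CM| * ‖z - 1‖ := mul_comm _ _
    linarith
  have h2 : 1 / 2 * ‖1 - z‖ ^ 2 * T ≤ |CT| * ‖z - 1‖ ^ 2 := by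
    rw [norm_sub_rev]
    have hT' : T ≤ |CT| := hT.trans (le_abs_self CT)
    have h0 : 0 ≤ ‖z - 1‖ ^ 2 := by positivity
    nlinarith [abs_nonneg CT]
  have hexp : -((1 - z.re) * μ) + 1 / 2 * ‖1 - z‖ ^ 2 * T ≤
      (k : ℝ) * (z.re - 1) * L + (|CM| + |CT|) * (‖z - 1‖ + ‖z - 1‖ ^ 2) := by
    nlinarith [h1, h2, abs_nonneg CM, abs_nonneg CT, norm_nonneg (z - 1), sq_nonneg ‖z - 1‖]
  have hrpow : (Real.log (x : ℝ)) ^ ((k : ℝ) * (z.re - 1)) = Real.exp ((k : ℝ) * (z.re - 1) * L) := by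
    rw [Real.rpow_def_of_pos hlogx, hL]; ring_nf
  calc ‖∑ n ∈ range (x + 1), z ^ (e n)‖
      ≤ ((x : ℝ) + 1) * Real.exp (-((1 - z.re) * μ) + 1 / 2 * ‖1 - z‖ ^ 2 * T) := hHad
    _ ≤ ((x : ℝ) + 1) * Real.exp ((k : ℝ) * (z.re - 1) * L + (|CM| + |CT|) * (‖z - 1‖ + ‖z - 1‖ ^ 2)) :=
        mul_le_mul_of_nonneg_left (Real.exp_le_exp.2 hexp) (by positivity)
    _ = ((x : ℝ) + 1) * (Real.log (x : ℝ)) ^ ((k : ℝ) * (z.re - 1)) *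
          Real.exp ((|CM| + |CT|) * (‖z - 1‖ + ‖z - 1‖ ^ 2)) := by
        rw [Real.exp_add, hrpow]; ring

end Summit.Parity.BatemanHorn.Cruxes.SystemZeroRepulsion.Reduction

end
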